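import Summits.HodgeConjecture.HodgeConjecture.Theses.LinearSystemTorelli
import Literature.AlgebraicGeometry.HodgeTheory.SupportedHodgeClassDescent
import Literature.AlgebraicGeometry.HodgeTheory.GysinFormalismPushforward
import Literature.AlgebraicGeometry.HodgeTheory.GysinFormalismCorrespondences
import Literature.AlgebraicGeometry.Motives.BaseChange

/-!
# Route `LinearSystemTorelli` — crux `MiddleDivisorSupportFourfold` (stmt-HodgeConjecture-2409):
# the `ℚ̄`-funnel needs NO intersection theory for DIVISOR support

Helper file for the crux item stmt-HodgeConjecture-2409 (`--supports`; it closes nothing), line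
`IdeatorFiveSketch` (idea `weakly-nonfactor-descent`), lead c2. The registered skeleton of the line
(`Cruxes/MiddleDivisorSupportFourfold/Lines/IdeatorFiveSketch.lean`) composes the crux from three
stubs — TRANSFER (`ℚ̄`-envelope of rational `(2,2)`-classes on fourfolds, the `(4,2)` instance of
`QbarEnvelope.Envelope`, stmt-1069), SECTOR (Hodge conjecture in codimension 2 over number fields,
the codimension-2 slice of `QbarEnvelope.HCOverNumberFields`, stmt-1070) and GLUE (pull-back of
codimension-2 algebraic classes is algebraic, the `p = 2` instance of the named fact
`fulton1998_map_mem_algebraicClasses`, Fulton Cor. 19.2 (b), UNDISCHARGED in the tree: it needs a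
cycle class with supports and the moving lemma / deformation to the normal cone).

This file records, kernel-checked and with no named fact, definition or `sorry`, that for THIS crux
the glue costs nothing: the crux asks only for DIVISOR support (`supportedClasses X 4 1 = N¹H⁴`),
and the pull-back of a class dying off a Zariski-closed `T ⊆ W` dies off `ι⁻¹T`
(`complexBetti.restrictCompl_map_eq_zero`), which is a proper closed subset of the integral fourfold
`X` — hence of codimension `≥ 1` (`one_le_coheight_of_mem_of_isClosed`) — as soon as `ι⁻¹T ≠ X`.
The latter holds whenever `ι` is dominant onto the `K`-model `W₀` of `W ≅ W₀ ⊗_{K,σ} ℂ` and `T` is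
the base change of a proper `K`-closed subset `Z₀ ⊊ W₀`; both conditions come for free in the
printed construction of the envelope (Charles–Schnell Thm 11.3.19: `X` is the fibre of the family
over the Hodge-locus component `S′` at a point `s`; replacing `S′` by the `ℚ̄`-Zariski closure of `s`
makes `X → W₀` dominant, and an algebraic class on a `ℚ̄`-variety is homologous to a
Galois-saturated `ℚ̄`-cycle, whose support is `K`-closed).

* `linearSystemTorelli_map_mem_supportedClasses_one_of_preimage_ne_univ` — the core: `ι^* d ∈ N¹Hⁱ(X)`
  for `d` dying off a closed `T ⊆ W` with `ι⁻¹T ≠ X`;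
* `linearSystemTorelli_map_mem_supportedClasses_one_of_denseRange` — `ι^*(Nʳ Hⁱ(W)) ⊆ N¹Hⁱ(X)` for
  `ι : X ⟶ W` DOMINANT and `r ≥ 1` (generalises the tree's `map_mem_supportedClasses_one_of_surjective`
  from surjective to dominant morphisms and from `r = 1` to `r ≥ 1`; no flatness);
* `linearSystemTorelli_map_mem_supportedClasses_one_of_denseRange_model` — the `K`-model version:
  `ι : X ⟶ W`, `e : W ≅ W₀ ⊗_{K,σ} ℂ`, `X → W₀` dominant, `d` dying off the base change of a proper
  `K`-closed `Z₀ ⊊ W₀` ⟹ `ι^* d ∈ N¹Hⁱ(X)`;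
* `linearSystemTorelli_middleDivisorSupportFourfold_of_dominantEnvelope` — **DominantEnvelope(4,2) ∧
  KRationalDivisorSupport(·,2) ⟹ crux**, with the glue PROVED: if every rational `(2,2)`-class on a
  smooth projective complex fourfold is `ι^* c'` for a rational `(2,2)`-class `c'` on a smooth
  projective `W ≅ W₀ ⊗_{K,σ} ℂ`, `K` a number field, with `X → W₀` dominant, and if every rational
  `(2,2)`-class on such a `W` dies off the base change of some proper `K`-closed subset of `W₀`
  (divisor support with `K`-rational support — implied by the Hodge conjecture over number fields
  in codimension 2 plus "algebraic classes on `W₀ ⊗ ℂ` have `K`-closed supports"), then the crux holds;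
* `linearSystemTorelli_envelopeFourfoldCodimTwo_of_dominantEnvelope` — the dominant envelope is a
  SHARPENING of the registered TRANSFER stub (forget dominance), so it is still implied by nothing
  weaker than stmt-1069 at `(4,2)` and implies it.

Consequence recorded for the crux chain: of the three debts of the line (stmt-1069, stmt-1070,
Fulton Cor. 19.2 (b)), the third is inessential for stmt-2409 — the crux is downstream of a
dominant `ℚ̄`-envelope and of `K`-rational divisor support of `(2,2)`-classes on varieties over
number fields, two statements each implied by the crux modulo classical theorems and jointly
implying it by the theorem below.
-/

noncomputable section

namespace Summit.HodgeConjecture.HodgeConjecture.Theorems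

open CategoryTheory AlgebraicGeometry
open Summit.HodgeConjecture.HodgeConjecture.Theses
open Summit.HodgeConjecture.HodgeConjecture.Theses.LinearSystemTorelli
open Literature.AlgebraicGeometry Literature.AlgebraicGeometry.HodgeTheory
open Literature.AlgebraicGeometry.Motives

variable {n m : ℕ} {X W : SchemeOver ℂ}

/-! ### Pull-back into `N¹` without intersection theory -/

/-- **Core.** For a `ℂ`-morphism `ι : X ⟶ W` with `X` smooth projective (integral), a class
`d ∈ Hⁱ(W(ℂ); ℂ)` dying off a Zariski-closed `T ⊆ W` whose preimage `ι⁻¹T` is not all of `X` pulls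
back into `N¹Hⁱ(X(ℂ); ℂ)`: `ι^* d` dies off `ι⁻¹T` (`complexBetti.restrictCompl_map_eq_zero`), a
proper closed subset of the irreducible `X`, all of whose points have codimension `≥ 1`
(`one_le_coheight_of_mem_of_isClosed`). [cite: GrothendieckTopology1969, §1] -/
theorem linearSystemTorelli_map_mem_supportedClasses_one_of_preimage_ne_univ
    (hX : IsSmoothProjective n X) (ι : X ⟶ W) {T : Set W.left} (hT : IsClosed T)
    (hpre : ι.left.base ⁻¹' T ≠ Set.univ) {i : ℕ} {d : complexBetti W i}
    (hd : complexBetti.restrictCompl W T i d = 0) :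
    complexBetti.map ι i d ∈ supportedClasses X i 1 :=
  mem_supportedClasses_of_restrictCompl_eq_zero (hT.preimage ι.left.continuous)
    (fun _ hz ↦ by
      exact_mod_cast one_le_coheight_of_mem_of_isClosed hX (hT.preimage ι.left.continuous) hpre hz)
    (complexBetti.restrictCompl_map_eq_zero ι hd)

/-- A closed subset of a topological space containing the range of a map with dense range is
everything. [folklore] -/
theorem linearSystemTorelli_eq_univ_of_denseRange_of_range_subset {α β : Type*}
    [TopologicalSpace β] {f : α → β} (hf : DenseRange f) {S : Set β} (hS : IsClosed S)
    (hfS : Set.range f ⊆ S) : S = Set.univ :=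
  Set.eq_univ_of_univ_subset (hf.closure_range ▸ closure_minimal hfS hS)

/-- The preimage of a proper closed subset under a map with dense range is a proper subset.
[folklore] -/
theorem linearSystemTorelli_preimage_ne_univ_of_denseRange {α β : Type*} [TopologicalSpace β]
    {f : α → β} (hf : DenseRange f) {S : Set β} (hS : IsClosed S) (hSne : S ≠ Set.univ) :
    f ⁻¹' S ≠ Set.univ := by
  intro h
  refine hSne (linearSystemTorelli_eq_univ_of_denseRange_of_range_subset hf hS ?_)
  rintro _ ⟨x, rfl⟩
  exact (h ▸ Set.mem_univ x : x ∈ f ⁻¹' S)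

/-- In a smooth projective (irreducible) `W`, a Zariski-closed subset all of whose points have
codimension `≥ r ≥ 1` is proper: it misses the generic point, which has codimension `0`.
[cite: Hartshorne1977, II Ex. 3.20] -/
theorem linearSystemTorelli_ne_univ_of_forall_le_coheight (hW : IsSmoothProjective m W)
    {S : Set W.left} {r : ℕ} (hr : 1 ≤ r) (hcoh : ∀ z ∈ S, (r : ℕ∞) ≤ Order.coheight z) :
    S ≠ Set.univ := by
  haveI := irreducibleSpace_of_isSmoothProjective' hW
  intro hS
  have h := hcoh (genericPoint W.left) (hS.symm ▸ Set.mem_univ _)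
  have hmax : IsMax (genericPoint W.left) := fun z _ ↦
    Scheme.le_iff_specializes.2 ((genericPoint_spec W.left).specializes (Set.mem_univ z))
  rw [Order.coheight_eq_zero.2 hmax] at h
  have h1 : ((1 : ℕ) : ℕ∞) ≤ (r : ℕ∞) := by exact_mod_cast hr
  exact absurd (h1.trans h) (by simp)

/-- **Dominant pull-back sends `Nʳ` (`r ≥ 1`) into `N¹`.** For `ι : X ⟶ W` dominant (dense image)
between smooth projective varieties and `d ∈ Nʳ Hⁱ(W(ℂ); ℂ)`, `r ≥ 1`: `ι^* d ∈ N¹Hⁱ(X(ℂ); ℂ)` — `d`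
dies off ONE closed `S` of codimension `≥ r` (`exists_isClosed_of_mem_supportedClasses`), `S ≠ W`,
so `ι⁻¹S ≠ X` by dominance. Generalises the tree's `map_mem_supportedClasses_one_of_surjective`
(surjective `ι`, `r = 1`); no flatness is needed in codimension `1`.
[cite: GrothendieckTopology1969, §1] -/
theorem linearSystemTorelli_map_mem_supportedClasses_one_of_denseRange
    (hX : IsSmoothProjective n X) (hW : IsSmoothProjective m W) (ι : X ⟶ W)
    (hι : DenseRange ι.left.base) {i r : ℕ} (hr : 1 ≤ r) {d : complexBetti W i}
    (hd : d ∈ supportedClasses W i r) : complexBetti.map ι i d ∈ supportedClasses X i 1 := by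
  obtain ⟨S, hS, hcoh, hdS⟩ := exists_isClosed_of_mem_supportedClasses hd
  exact linearSystemTorelli_map_mem_supportedClasses_one_of_preimage_ne_univ hX ι hS
    (linearSystemTorelli_preimage_ne_univ_of_denseRange hι hS
      (linearSystemTorelli_ne_univ_of_forall_le_coheight hW hr hcoh)) hdS

/-- **The `K`-model version.** Let `ι : X ⟶ W` be a `ℂ`-morphism from a smooth projective `X`, let
`e : W ≅ W₀ ⊗_{K,σ} ℂ` exhibit `W` as the base change of a `K`-scheme `W₀` along `σ : K →+* ℂ`, and
suppose the composite `X → W → W₀ ⊗_{K,σ} ℂ → W₀` is DOMINANT (dense image; e.g. `X` the fibre of a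
`K`-family over a `K`-generic point). Then a class `d ∈ Hⁱ(W(ℂ); ℂ)` dying off the base change of a
proper `K`-closed `Z₀ ⊊ W₀` pulls back into `N¹Hⁱ(X(ℂ); ℂ)`. [cite: GrothendieckTopology1969, §1] -/
theorem linearSystemTorelli_map_mem_supportedClasses_one_of_denseRange_model
    (hX : IsSmoothProjective n X) (ι : X ⟶ W) {K : Type} [Field K] (σ : K →+* ℂ)
    (W₀ : SchemeOver K) (e : W ≅ (baseChangeHom σ).obj W₀)
    (hdom : DenseRange (ι.left ≫ e.hom.left ≫ baseChangeHomFst σ W₀).base)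
    {Z₀ : Set W₀.left} (hZ₀ : IsClosed Z₀) (hZ₀ne : Z₀ ≠ Set.univ) {i : ℕ} {d : complexBetti W i}
    (hd : complexBetti.restrictCompl W ((e.hom.left ≫ baseChangeHomFst σ W₀).base ⁻¹' Z₀) i d = 0) :
    complexBetti.map ι i d ∈ supportedClasses X i 1 := by
  refine linearSystemTorelli_map_mem_supportedClasses_one_of_preimage_ne_univ hX ι
    (hZ₀.preimage (e.hom.left ≫ baseChangeHomFst σ W₀).continuous) ?_ hd
  -- `ι⁻¹(π⁻¹ Z₀) = (ι ≫ π)⁻¹ Z₀` definitionally (`Scheme.comp_base`, `Over.comp_left` are `rfl`)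
  exact linearSystemTorelli_preimage_ne_univ_of_denseRange hdom hZ₀ hZ₀ne

/-! ### The Fulton-free composition -/

/-- **DominantEnvelope(4,2) ∧ KRationalDivisorSupport(·,2) ⟹ crux.** If every rational
`(2,2)`-class `c` on a smooth projective complex fourfold `X` is `ι^* c'` for a rational
`(2,2)`-class `c'` on a smooth projective `W ≅ W₀ ⊗_{K,σ} ℂ`, `K` a number field, with
`X → W₀` dominant (`hE`: the output of the printed envelope construction — Charles–Schnell
Thm 11.3.19 over the `ℚ̄`-Zariski closure of the moduli point), and if every rational `(2,2)`-class
on such a `W` dies off the base change of some proper `K`-closed subset of `W₀` (`hQ`: divisor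
support with `K`-rational support, implied by the Hodge conjecture over number fields in
codimension 2 together with "algebraic classes on `W₀ ⊗ ℂ` are homologous to Galois-saturated
`ℚ̄`-cycles"), then every rational `(2,2)`-class on a smooth projective complex fourfold is supported
on a divisor. The glue is `linearSystemTorelli_map_mem_supportedClasses_one_of_denseRange_model`:
no cycle class, moving lemma or `fulton1998_map_mem_algebraicClasses` is used.
[cite: CharlesSchnell2014Notes, Thm 11.3.19] [cite: Voisin2007HodgeLoci, Prop. 1.7]
[cite: GrothendieckTopology1969, §1] -/
theorem linearSystemTorelli_middleDivisorSupportFourfold_of_dominantEnvelope :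
    (∀ ⦃X : SchemeOver ℂ⦄, IsSmoothProjective 4 X → ∀ (c : complexBetti X 4),
      IsRationalClass c → IsOfHodgeType 4 X 4 2 2 c →
        ∃ (m : ℕ) (W : SchemeOver ℂ) (ι : X ⟶ W) (c' : complexBetti W 4) (K : Type) (_ : Field K)
          (_ : NumberField K) (σ : K →+* ℂ) (W₀ : SchemeOver K) (e : W ≅ (baseChangeHom σ).obj W₀),
          IsSmoothProjective m W ∧ DenseRange (ι.left ≫ e.hom.left ≫ baseChangeHomFst σ W₀).base ∧
          IsRationalClass c' ∧ IsOfHodgeType m W 4 2 2 c' ∧ complexBetti.map ι 4 c' = c) →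
    (∀ ⦃m : ℕ⦄ ⦃W : SchemeOver ℂ⦄, IsSmoothProjective m W → ∀ (K : Type) (_ : Field K)
      (_ : NumberField K) (σ : K →+* ℂ) (W₀ : SchemeOver K) (e : W ≅ (baseChangeHom σ).obj W₀),
      ∀ (c' : complexBetti W 4), IsRationalClass c' → IsOfHodgeType m W 4 2 2 c' →
        ∃ Z₀ : Set W₀.left, IsClosed Z₀ ∧ Z₀ ≠ Set.univ ∧
          complexBetti.restrictCompl W ((e.hom.left ≫ baseChangeHomFst σ W₀).base ⁻¹' Z₀) 4 c' = 0) →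
    MiddleDivisorSupportFourfold := by
  intro hE hQ X hX c hc hh
  obtain ⟨m, W, ι, c', K, hK, hN, σ, W₀, e, hW, hdom, hc', hh', hmap⟩ := hE hX c hc hh
  obtain ⟨Z₀, hZ₀, hZ₀ne, hd⟩ := hQ hW K hK hN σ W₀ e c' hc' hh'
  rw [← hmap]
  exact linearSystemTorelli_map_mem_supportedClasses_one_of_denseRange_model hX ι σ W₀ e hdom hZ₀
    hZ₀ne hd

/-- **The dominant envelope sharpens the registered TRANSFER stub** (`stub_envelopeFourfoldCodimTwo`
of the line's skeleton = the `(4,2)` instance of `QbarEnvelope.Envelope`, stmt-1069): forgetting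
dominance and keeping the isomorphism only up to `Nonempty` gives the stub's conclusion verbatim.
So `hE` above is implied by nothing weaker than stmt-1069 at `(4,2)` and implies it.
[cite: Voisin2007HodgeLoci, Prop. 1.7] [cite: CharlesSchnell2014Notes, Thm 11.3.19] -/
theorem linearSystemTorelli_envelopeFourfoldCodimTwo_of_dominantEnvelope
    (hE : ∀ ⦃X : SchemeOver ℂ⦄, IsSmoothProjective 4 X → ∀ (c : complexBetti X 4),
      IsRationalClass c → IsOfHodgeType 4 X 4 2 2 c →
        ∃ (m : ℕ) (W : SchemeOver ℂ) (ι : X ⟶ W) (c' : complexBetti W 4) (K : Type) (_ : Field K)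
          (_ : NumberField K) (σ : K →+* ℂ) (W₀ : SchemeOver K) (e : W ≅ (baseChangeHom σ).obj W₀),
          IsSmoothProjective m W ∧ DenseRange (ι.left ≫ e.hom.left ≫ baseChangeHomFst σ W₀).base ∧
          IsRationalClass c' ∧ IsOfHodgeType m W 4 2 2 c' ∧ complexBetti.map ι 4 c' = c) :
    ∀ ⦃X : SchemeOver ℂ⦄, IsSmoothProjective 4 X → ∀ (c : complexBetti X 4), IsRationalClass c →
      IsOfHodgeType 4 X 4 2 2 c →
        ∃ (m : ℕ) (W : SchemeOver ℂ) (ι : X ⟶ W) (c' : complexBetti W 4), IsSmoothProjective m W ∧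
          (∃ (K : Type) (_ : Field K) (_ : NumberField K) (σ : K →+* ℂ) (W₀ : SchemeOver K),
            Nonempty (W ≅ (baseChangeHom σ).obj W₀)) ∧
          IsRationalClass c' ∧ IsOfHodgeType m W 4 2 2 c' ∧ complexBetti.map ι 4 c' = c := by
  intro X hX c hc hh
  obtain ⟨m, W, ι, c', K, hK, hN, σ, W₀, e, hW, -, hc', hh', hmap⟩ := hE hX c hc hh
  exact ⟨m, W, ι, c', hW, ⟨K, hK, hN, σ, W₀, ⟨e⟩⟩, hc', hh', hmap⟩

end Summit.HodgeConjecture.HodgeConjecture.Theorems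

end
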